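import Literature.NumberTheory.NumberFields.EquivariantIwasawaLemmaAbsoluteSplit
import Mathlib.FieldTheory.LinearDisjoint
import HarnessLib

/-!
# The equivariant Iwasawa lemma, XI: the composita `L₀K_n` with the base hypothesis on the `S`-split
# class group — PROVED

Topic `NumberTheory/NumberFields` (namespace = path, grouping sub-namespace `EquivariantIwasawaLemma`).
THEOREM-ONLY file (no definition, no named fact, no `sorry`), written by the literature seat
`bsd-potss-conjA-anchor` g17 (cell `bsd-potss`; serves the asides stmt-BirchSwinnertonDyer-19386 / 19413;
closes nothing).  The `S`-version of file V (`EquivariantIwasawaLemmaCompositum.lean`):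
`equivariantHom_classGroup_eq_zero_compositum_tower_of_splitAt` — `L_n = L₀K_n` (`p ∤ [L₀ : k]`, `K_n/k`
abelian of degree `pⁿ`), `V` a `p`-torsion `Γ_k`-module with `Γ_{L₀}` trivial, (c3*)ₙ and (orbit)ₙ at
every layer as in file V, and at the bottom ONLY `Hom_{Γ_k}(H′_{L₀,Sk}, V) = 0` (equivariant additive maps
`Cl(𝓞_{L₀}) → V` killing the classes of the primes above a set `Sk` of places of `k` vanish) together with
(c3*) at the primes of `L₁ = L₀K₁` above `Sk`; THEN every `Γ_k`-equivariant additive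
`Cl(𝓞_{L_{n+1}}) → V` is zero for every `n`.  Proof = file V verbatim (degrees by linear disjointness,
centrality from the abelian `K_n`), feeding file X's `equivariantHom_classGroup_eq_zero_tower_of_splitAt`.

## References

* L. C. Washington, *Introduction to Cyclotomic Fields*, 2nd ed., GTM 83 (1997), §13.3, Thm. 10.4.
  [Washington1997]
* S. V. Deo, A. Ray, R. Sujatha, Pure Appl. Math. Q. 19 (2023), §3 Thm. 3.8 (c2), (c3) (arXiv:2202.09937
  p. 9). [DeoRaySujatha2023]
-/

noncomputable section

open scoped Pointwise nonZeroDivisors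
open NumberField Field IntermediateField Ideal IsDedekindDomain
open Literature.NumberTheory.GaloisRepresentations

namespace Literature.NumberTheory.NumberFields

namespace EquivariantIwasawaLemma

section CompositumS

variable {k : Type} [Field k]

/-- `((τ|_E) x : k̄) = τ • x`. [folklore] -/
private theorem coe_absRestrictNormalHom_applyC (E : IntermediateField k (AlgebraicClosure k))
    [Normal k E] (τ : absoluteGaloisGroup k) (x : E) :
    ((absRestrictNormalHom E τ x : E) : AlgebraicClosure k) = τ • (x : AlgebraicClosure k) :=
  AlgEquiv.restrictNormalHom_apply E _ x

/-- `τ|_E = 1` iff `τ ∈ Gal(k̄/E)` (Mathlib's `fixingSubgroup`, through the identification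
`absoluteGaloisGroup.toAlgEquiv`). [folklore] -/
private theorem absRestrictNormalHom_eq_one_iff_mem_fixingSubgroupC
    (E : IntermediateField k (AlgebraicClosure k)) [Normal k E] (τ : absoluteGaloisGroup k) :
    absRestrictNormalHom E τ = 1 ↔ absoluteGaloisGroup.toAlgEquiv k τ ∈ E.fixingSubgroup := by
  rw [IntermediateField.mem_fixingSubgroup_iff]
  constructor
  · intro h x hx
    change τ • x = x
    rw [← coe_absRestrictNormalHom_applyC E τ ⟨x, hx⟩, h, AlgEquiv.one_apply]
  · intro h
    ext x
    rw [coe_absRestrictNormalHom_applyC E τ x, AlgEquiv.one_apply]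
    exact h x x.2

/-- `τ|_{E₁E₂} = 1 ↔ τ|_{E₁} = 1 ∧ τ|_{E₂} = 1` (`Gal(k̄/E₁E₂) = Gal(k̄/E₁) ∩ Gal(k̄/E₂)`, Mathlib
`IntermediateField.fixingSubgroup_sup`). [folklore] -/
private theorem absRestrictNormalHom_sup_eq_one_iffC (E₁ E₂ : IntermediateField k (AlgebraicClosure k))
    [Normal k E₁] [Normal k E₂] (τ : absoluteGaloisGroup k) :
    absRestrictNormalHom (E₁ ⊔ E₂ : IntermediateField k (AlgebraicClosure k)) τ = 1 ↔
      absRestrictNormalHom E₁ τ = 1 ∧ absRestrictNormalHom E₂ τ = 1 := by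
  rw [absRestrictNormalHom_eq_one_iff_mem_fixingSubgroupC, absRestrictNormalHom_eq_one_iff_mem_fixingSubgroupC,
    absRestrictNormalHom_eq_one_iff_mem_fixingSubgroupC, IntermediateField.fixingSubgroup_sup,
    Subgroup.mem_inf]

/-- If `τ|_{E'} = 1` and `E ≤ E'` then `τ|_E = 1`. [folklore] -/
private theorem absRestrictNormalHom_eq_one_of_leC {E E' : IntermediateField k (AlgebraicClosure k)}
    [Normal k E] [Normal k E'] (h : E ≤ E') (τ : absoluteGaloisGroup k)
    (hτ : absRestrictNormalHom E' τ = 1) : absRestrictNormalHom E τ = 1 := by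
  rw [absRestrictNormalHom_eq_one_iff_mem_fixingSubgroupC] at hτ ⊢
  exact IntermediateField.fixingSubgroup_antitone h hτ

/-- **`Gal(E₀E/E₀·)`-type centrality.**  If `Gal(E/k)` is abelian (`(στ)|_E = (τσ)|_E`) and `σ|_{E₀} = 1`,
then `(στ)|_{E₀E} = (τσ)|_{E₀E}`: the commutator is trivial on `E₀` (because `σ` is) and on `E`. [folklore] -/
private theorem absRestrictNormalHom_sup_mul_commC (E₀ E : IntermediateField k (AlgebraicClosure k))
    [Normal k E₀] [Normal k E]
    (hE : ∀ σ τ : absoluteGaloisGroup k, absRestrictNormalHom E (σ * τ) = absRestrictNormalHom E (τ * σ))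
    (σ τ : absoluteGaloisGroup k) (hσ : absRestrictNormalHom E₀ σ = 1) :
    absRestrictNormalHom (E₀ ⊔ E : IntermediateField k (AlgebraicClosure k)) (σ * τ) =
      absRestrictNormalHom (E₀ ⊔ E : IntermediateField k (AlgebraicClosure k)) (τ * σ) := by
  rw [← mul_inv_eq_one, ← map_inv, ← map_mul, absRestrictNormalHom_sup_eq_one_iffC]
  constructor
  · rw [map_mul, map_inv, map_mul, map_mul, hσ, one_mul, mul_one, mul_inv_cancel]
  · rw [map_mul, map_inv, hE σ τ, mul_inv_cancel]

variable [NumberField k]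

set_option maxHeartbeats 1000000 in
set_option synthInstance.maxHeartbeats 100000 in
/-- **The equivariant Iwasawa lemma for the composita `L_n = L₀K_n`, with the base hypothesis on the
`S`-split class group.**  As `equivariantHom_classGroup_eq_zero_compositum_tower` (file V): `k` a number
field, `p` odd, `L₀ ⊆ k̄` finite Galois with `p ∤ [L₀ : k]`, `K₀ = k ⊆ K₁ ⊆ ⋯` finite abelian over `k` with
`[K_n : k] = pⁿ`, `L_n := L₀ ⊔ K_n`, `V` a `p`-torsion `Γ_k`-module with `Γ_{L₀}` trivial, (c3*)ₙ at the
primes of `L_{n+1}` ramified over `L_n` and (orbit)ₙ, for every `n`; but at the bottom only: every additive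
`Γ_k`-equivariant `μ : Cl(𝓞_{L₀}) → V` killing the classes of the primes of `L₀` above the places in `Sk`
is zero (`Hom_{Γ_k}(H′_{L₀,Sk}, V) = 0`, Deo–Ray–Sujatha's (c2)), plus (c3*) at the primes of `L₁` above
`Sk`.  Then for every `n` every additive `Γ_k`-equivariant `Cl(𝓞_{L_{n+1}}) → V` is zero.
[cite: Washington1997, §13.3 Lemmas 13.14–13.15 and Thm. 10.4 (proof)]
[cite: DeoRaySujatha2023, §3 Thm. 3.8 (c2), (c3) and the definition of H′_L (arXiv:2202.09937 p. 9)] -/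
theorem equivariantHom_classGroup_eq_zero_compositum_tower_of_splitAt (p : ℕ) [Fact p.Prime]
    (hp2 : p ≠ 2)
    (L₀ : IntermediateField k (AlgebraicClosure k)) [FiniteDimensional k L₀] [IsGalois k L₀]
    [NumberField L₀]
    (hL₀ : ¬ p ∣ Module.finrank k L₀)
    (K : ℕ → IntermediateField k (AlgebraicClosure k)) (hKmono : ∀ n, K n ≤ K (n + 1)) (hK0 : K 0 = ⊥)
    [∀ n, FiniteDimensional k (K n)] [hKab : ∀ n, IsAbelianGalois k (K n)]
    (hKdeg : ∀ n, Module.finrank k (K n) = p ^ n)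
    [hNF : ∀ n, NumberField (L₀ ⊔ K n : IntermediateField k (AlgebraicClosure k))]
    {V : Type*} [AddCommGroup V] [DistribMulAction (absoluteGaloisGroup k) V]
    (hpV : ∀ v : V, p • v = 0)
    (hV : ∀ τ : absoluteGaloisGroup k, absRestrictNormalHom L₀ τ = 1 → ∀ v : V, τ • v = v)
    (Sk : HeightOneSpectrum (𝓞 k) → Prop)
    (hDbad : ∀ (𝔓 : Ideal (𝓞 (L₀ ⊔ K 1 : IntermediateField k (AlgebraicClosure k)))) [𝔓.IsMaximal]
      (u : HeightOneSpectrum (𝓞 k)), Sk u → 𝔓.under (𝓞 k) = u.asIdeal →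
      ∀ v : V, (∀ τ : absoluteGaloisGroup k,
        absRestrictNormalHom (L₀ ⊔ K 1 : IntermediateField k (AlgebraicClosure k)) τ • 𝔓 = 𝔓 →
          τ • v = v) → v = 0)
    (h0 : ∀ μ : Additive (ClassGroup (𝓞 L₀)) →+ V,
      (∀ (τ : absoluteGaloisGroup k) (c : ClassGroup (𝓞 L₀)),
        μ (Additive.ofMul (ClassGroup.mulEquiv
          (AmbiguousClass.intAut (absRestrictNormalHom L₀ τ)) c)) = τ • μ (Additive.ofMul c)) →
      (∀ (v : HeightOneSpectrum (𝓞 L₀)) (u : HeightOneSpectrum (𝓞 k)), Sk u →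
        v.asIdeal.under (𝓞 k) = u.asIdeal →
        μ (Additive.ofMul (ClassGroup.mk0 ⟨v.asIdeal, mem_nonZeroDivisors_of_ne_zero v.ne_bot⟩)) = 0) →
      μ = 0)
    (hD : ∀ (n : ℕ) (𝔓 : Ideal (𝓞 (L₀ ⊔ K (n + 1) : IntermediateField k (AlgebraicClosure k))))
      [𝔓.IsMaximal],
      (∃ σ : absoluteGaloisGroup k,
        absRestrictNormalHom (L₀ ⊔ K (n + 1) : IntermediateField k (AlgebraicClosure k)) σ ∈
          𝔓.inertia ((L₀ ⊔ K (n + 1) : IntermediateField k (AlgebraicClosure k)) ≃ₐ[k]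
            (L₀ ⊔ K (n + 1) : IntermediateField k (AlgebraicClosure k))) ∧
        absRestrictNormalHom L₀ σ = 1 ∧ absRestrictNormalHom (K n) σ = 1 ∧
        absRestrictNormalHom (K (n + 1)) σ ≠ 1) →
      ∀ v : V, (∀ τ : absoluteGaloisGroup k,
        absRestrictNormalHom (L₀ ⊔ K (n + 1) : IntermediateField k (AlgebraicClosure k)) τ • 𝔓 = 𝔓 →
          τ • v = v) → v = 0)
    (horb : ∀ n : ℕ, ∃ (𝔓₀ : Ideal (𝓞 (L₀ ⊔ K (n + 1) : IntermediateField k (AlgebraicClosure k))))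
      (_ : 𝔓₀.IsMaximal),
      (∃ σ : absoluteGaloisGroup k,
        absRestrictNormalHom (L₀ ⊔ K (n + 1) : IntermediateField k (AlgebraicClosure k)) σ ∈
          𝔓₀.inertia ((L₀ ⊔ K (n + 1) : IntermediateField k (AlgebraicClosure k)) ≃ₐ[k]
            (L₀ ⊔ K (n + 1) : IntermediateField k (AlgebraicClosure k))) ∧
        absRestrictNormalHom L₀ σ = 1 ∧ absRestrictNormalHom (K n) σ = 1 ∧
        absRestrictNormalHom (K (n + 1)) σ ≠ 1) ∧
      ¬ p ∣ (MulAction.stabilizer ((L₀ ⊔ K (n + 1) : IntermediateField k (AlgebraicClosure k)) ≃ₐ[k]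
        (L₀ ⊔ K (n + 1) : IntermediateField k (AlgebraicClosure k))) 𝔓₀).index)
    (n : ℕ)
    (f : Additive (ClassGroup (𝓞 (L₀ ⊔ K (n + 1) : IntermediateField k (AlgebraicClosure k)))) →+ V)
    (hf : ∀ (τ : absoluteGaloisGroup k)
        (c : ClassGroup (𝓞 (L₀ ⊔ K (n + 1) : IntermediateField k (AlgebraicClosure k)))),
      f (Additive.ofMul (ClassGroup.mulEquiv (AmbiguousClass.intAut
        (absRestrictNormalHom (L₀ ⊔ K (n + 1) : IntermediateField k (AlgebraicClosure k)) τ)) c)) =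
        τ • f (Additive.ofMul c)) :
    f = 0 := by
  have hp : p.Prime := Fact.out
  haveI hKn : ∀ n, Normal k (K n) := fun n => inferInstance
  have hKab' : ∀ (n : ℕ) (σ τ : absoluteGaloisGroup k),
      absRestrictNormalHom (K n) (σ * τ) = absRestrictNormalHom (K n) (τ * σ) := fun n σ τ => by
    rw [map_mul, map_mul]
    exact (hKab n).toIsMulCommutative.is_comm.comm _ _
  haveI hL₀n : Normal k L₀ := inferInstance
  -- the tower `L n = L₀ ⊔ K n`
  set L : ℕ → IntermediateField k (AlgebraicClosure k) := fun n => L₀ ⊔ K n with hLdef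
  have hL : ∀ n, L n = L₀ ⊔ K n := fun n => rfl
  have hmono : ∀ n, L n ≤ L (n + 1) := fun n => sup_le_sup_left (hKmono n) L₀
  have hLgal : ∀ n, IsGalois k (L n) := fun n => inferInstance
  haveI hLn : ∀ n, Normal k (L n) := fun n => (hLgal n).to_normal
  -- degrees: `[L₀ K_n : k] = [L₀ : k] pⁿ` (linear disjointness, coprime degrees)
  have hdegL : ∀ n, Module.finrank k (L n) = Module.finrank k L₀ * p ^ n := by
    intro n
    have hcop : (Module.finrank k L₀).Coprime (Module.finrank k (K n)) := by
      rw [hKdeg]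
      exact (Nat.coprime_comm.mp (hp.coprime_iff_not_dvd.mpr hL₀)).pow_right n
    rw [hL, (IntermediateField.LinearDisjoint.of_finrank_coprime hcop).finrank_sup, hKdeg]
  have hdeg : ∀ n, Module.finrank k (L (n + 1)) = p * Module.finrank k (L n) := by
    intro n
    rw [hdegL, hdegL, pow_succ]
    ring
  -- centrality
  have hcent : ∀ (n : ℕ) (σ τ : absoluteGaloisGroup k), absRestrictNormalHom (L n) σ = 1 →
      absRestrictNormalHom (L (n + 1)) (σ * τ) = absRestrictNormalHom (L (n + 1)) (τ * σ) := by
    intro n σ τ hσ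
    exact absRestrictNormalHom_sup_mul_commC L₀ (K (n + 1)) (hKab' (n + 1)) σ τ
      (absRestrictNormalHom_eq_one_of_leC le_sup_left σ hσ)
  -- `Γ_{L 0}` acts trivially
  have hV' : ∀ τ : absoluteGaloisGroup k, absRestrictNormalHom (L 0) τ = 1 → ∀ v : V, τ • v = v :=
    fun τ hτ => hV τ (absRestrictNormalHom_eq_one_of_leC le_sup_left τ hτ)
  -- (c2*) at `L 0 = L₀ ⊔ ⊥ = L₀`
  have hL0 : L 0 = L₀ := by rw [hL, hK0, sup_bot_eq]
  have h0' : ∀ (E : IntermediateField k (AlgebraicClosure k)), E = L₀ → ∀ [Normal k E] [NumberField E],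
      ∀ μ : Additive (ClassGroup (𝓞 E)) →+ V,
        (∀ (τ : absoluteGaloisGroup k) (c : ClassGroup (𝓞 E)),
          μ (Additive.ofMul (ClassGroup.mulEquiv
            (AmbiguousClass.intAut (absRestrictNormalHom E τ)) c)) = τ • μ (Additive.ofMul c)) →
        (∀ (v : HeightOneSpectrum (𝓞 E)) (u : HeightOneSpectrum (𝓞 k)), Sk u →
          v.asIdeal.under (𝓞 k) = u.asIdeal →
          μ (Additive.ofMul (ClassGroup.mk0 ⟨v.asIdeal, mem_nonZeroDivisors_of_ne_zero v.ne_bot⟩)) =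
            0) →
        μ = 0 := by
    rintro E rfl _ _ μ hμ hμS
    exact h0 μ hμ hμS
  -- ramification hypotheses in the form of the tower theorem
  have hram : ∀ (n : ℕ) (σ : absoluteGaloisGroup k), absRestrictNormalHom (L (n + 1)) σ ≠ 1 →
      absRestrictNormalHom (L n) σ = 1 →
      absRestrictNormalHom L₀ σ = 1 ∧ absRestrictNormalHom (K n) σ = 1 ∧
        absRestrictNormalHom (K (n + 1)) σ ≠ 1 := by
    intro n σ hne h1
    obtain ⟨h0σ, hnσ⟩ := (absRestrictNormalHom_sup_eq_one_iffC L₀ (K n) σ).mp h1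
    refine ⟨h0σ, hnσ, fun h => hne ?_⟩
    exact (absRestrictNormalHom_sup_eq_one_iffC L₀ (K (n + 1)) σ).mpr ⟨h0σ, h⟩
  have hram' : ∀ (n : ℕ) (σ : absoluteGaloisGroup k), absRestrictNormalHom L₀ σ = 1 →
      absRestrictNormalHom (K n) σ = 1 → absRestrictNormalHom (K (n + 1)) σ ≠ 1 →
      absRestrictNormalHom (L (n + 1)) σ ≠ 1 ∧ absRestrictNormalHom (L n) σ = 1 := by
    intro n σ h0σ hnσ hne
    refine ⟨fun h => hne (absRestrictNormalHom_eq_one_of_leC le_sup_right σ h), ?_⟩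
    exact (absRestrictNormalHom_sup_eq_one_iffC L₀ (K n) σ).mpr ⟨h0σ, hnσ⟩
  refine equivariantHom_classGroup_eq_zero_tower_of_splitAt (hGal := hLgal) p hp2 L hmono hdeg hcent
    hpV hV' ?_ ?_ Sk hDbad (h0' (L 0) hL0) n f hf
  · intro n 𝔓 _ hex v hv
    obtain ⟨σ, hI, hne, h1⟩ := hex
    obtain ⟨h0σ, hnσ, hne'⟩ := hram n σ hne h1
    exact hD n 𝔓 ⟨σ, hI, h0σ, hnσ, hne'⟩ v hv
  · intro n
    obtain ⟨𝔓₀, h𝔓₀, ⟨σ, hI, h0σ, hnσ, hne⟩, hidx⟩ := horb n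
    obtain ⟨hne', h1⟩ := hram' n σ h0σ hnσ hne
    exact ⟨𝔓₀, h𝔓₀, ⟨σ, hI, hne', h1⟩, hidx⟩


end CompositumS

end EquivariantIwasawaLemma

end Literature.NumberTheory.NumberFields

end
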